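import Mathlib.Analysis.SpecialFunctions.Pow.Deriv
import Mathlib.Analysis.SpecialFunctions.Log.Deriv
import Mathlib.MeasureTheory.Integral.IntervalIntegral.FundThmCalculus
import HarnessLib

/-!
# Stub `stub_calBulk` — the bulk majorant of the calibration string
(crux `LeeYang.LeeyangThesis`, line Sketch, card telegraph-string; calibration sub-programme,
RH-free real analysis)

For `0 < L`, `e·L ≤ A`, `0 < r` put `u(y) = log (A/(L-y))`, `u_L = log (A/L)` and
`g₁(y) = (u(y)/u_L)^r` on `[0, L)`.  Since `L - y ∈ (0, L] ⊆ (0, A/e]` we have `u ≥ 1` there,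
`u' = 1/(L-y)`, hence `g₁' = r g₁ /((L-y) u)`, `g₁(0) = 1`, `g₁ ≥ 1`, `g₁` is monotone, and for
`h = g₁' = r P g₁`, `P = 1/((L-y)u)`, one has `P' = (u-1)/((L-y)²u²) ≥ 0`, so
`h' = r P' g₁ + r² P² g₁ ≥ r² ρ g₁` with `ρ = P² = 1/((L-y)² u²)`; integrating (FTC) gives
`h(0) + r² ∫₀ʸ ρ g₁ ≤ h(y)` with `h(0) = r/(L u_L)`.
-/

noncomputable section

set_option linter.dupNamespace false

open MeasureTheory Filter Topology Set

namespace Summit.RiemannHypothesis.RiemannHypothesis.Theorems.LeeYangTelegraphString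

/-- `1 ≤ log (A/t)` for `0 < t ≤ L` when `e·L ≤ A`. -/
private lemma calBulk_one_le_log {L A t : ℝ} (hA : Real.exp 1 * L ≤ A) (ht : 0 < t)
    (htL : t ≤ L) : 1 ≤ Real.log (A / t) := by
  have h1 : Real.exp 1 * t ≤ A :=
    le_trans (mul_le_mul_of_nonneg_left htL (Real.exp_pos 1).le) hA
  have h2 : Real.exp 1 ≤ A / t := by rwa [le_div_iff₀ ht]
  calc (1 : ℝ) = Real.log (Real.exp 1) := (Real.log_exp 1).symm
    _ ≤ Real.log (A / t) := Real.log_le_log (Real.exp_pos 1) h2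

/-- `y ↦ log (A/(L-y))` is non-decreasing on `(-∞, L)`. -/
private lemma calBulk_log_mono {L A a b : ℝ} (hA : 0 < A) (hb : b < L) (hab : a ≤ b) :
    Real.log (A / (L - a)) ≤ Real.log (A / (L - b)) := by
  have hb' : 0 < L - b := sub_pos.mpr hb
  have ha' : 0 < L - a := lt_of_lt_of_le hb' (by linarith)
  exact Real.log_le_log (div_pos hA ha') (div_le_div_of_nonneg_left hA.le hb' (by linarith))

/-- Derivative of `u(y) = log (A/(L-y))`: `u' = 1/(L-y)`. -/
private lemma calBulk_hasDerivAt_u {L A x : ℝ} (hA : 0 < A) (hLx : 0 < L - x) :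
    HasDerivAt (fun y : ℝ => Real.log (A / (L - y))) (1 / (L - x)) x := by
  have h1 : HasDerivAt (fun y : ℝ => A / (L - y)) ((0 * (L - x) - A * (-1)) / (L - x) ^ 2) x :=
    (hasDerivAt_const x A).fun_div ((hasDerivAt_id' x).const_sub L) hLx.ne'
  refine (h1.log (div_pos hA hLx).ne').congr_deriv ?_
  have hLx' : L - x ≠ 0 := hLx.ne'
  have hA' : A ≠ 0 := hA.ne'
  field_simp
  ring

/-- Derivative of the bulk majorant `g₁(y) = (u(y)/u_L)^r`: `g₁' = r g₁ /((L-y) u)`. -/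
private lemma calBulk_hasDerivAt_g {L A r x : ℝ} (hA : 0 < A) (hLx : 0 < L - x)
    (hu : 0 < Real.log (A / (L - x))) (huL : 0 < Real.log (A / L)) :
    HasDerivAt (fun y : ℝ => (Real.log (A / (L - y)) / Real.log (A / L)) ^ r)
      (r * (Real.log (A / (L - x)) / Real.log (A / L)) ^ r /
        ((L - x) * Real.log (A / (L - x)))) x := by
  have hq : Real.log (A / (L - x)) / Real.log (A / L) ≠ 0 := (div_pos hu huL).ne'
  have h1 := ((calBulk_hasDerivAt_u hA hLx).div_const (Real.log (A / L))).rpow_const (p := r)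
    (Or.inl hq)
  refine h1.congr_deriv ?_
  rw [Real.rpow_sub_one hq]
  have hLx' : L - x ≠ 0 := hLx.ne'
  have hu' : Real.log (A / (L - x)) ≠ 0 := hu.ne'
  have huL' : Real.log (A / L) ≠ 0 := huL.ne'
  field_simp

/-- Derivative of `h = g₁' = r g₁/((L-y)u)`:
`h' = (r² g₁ + r g₁ (u - 1))/((L-y)² u²)`. -/
private lemma calBulk_hasDerivAt_h {L A r x : ℝ} (hA : 0 < A) (hLx : 0 < L - x)
    (hu : 0 < Real.log (A / (L - x))) (huL : 0 < Real.log (A / L)) :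
    HasDerivAt (fun y : ℝ => r * (Real.log (A / (L - y)) / Real.log (A / L)) ^ r /
        ((L - y) * Real.log (A / (L - y))))
      ((r ^ 2 * (Real.log (A / (L - x)) / Real.log (A / L)) ^ r +
          r * (Real.log (A / (L - x)) / Real.log (A / L)) ^ r * (Real.log (A / (L - x)) - 1)) /
        ((L - x) ^ 2 * Real.log (A / (L - x)) ^ 2)) x := by
  have hg := calBulk_hasDerivAt_g (r := r) hA hLx hu huL
  have hden := ((hasDerivAt_id' x).const_sub L).fun_mul (calBulk_hasDerivAt_u hA hLx)
  have h := (hg.const_mul r).fun_div hden (mul_ne_zero hLx.ne' hu.ne')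
  refine h.congr_deriv ?_
  have hLx' : L - x ≠ 0 := hLx.ne'
  have hu' : Real.log (A / (L - x)) ≠ 0 := hu.ne'
  have huL' : Real.log (A / L) ≠ 0 := huL.ne'
  field_simp
  ring

/-- Continuity of `h'` at a point of `(-∞, L)` where `u > 0`. -/
private lemma calBulk_continuousAt_h' {L A r x : ℝ} (hA : 0 < A) (hLx : 0 < L - x)
    (hu : 0 < Real.log (A / (L - x))) (huL : 0 < Real.log (A / L)) :
    ContinuousAt (fun y : ℝ =>
      (r ^ 2 * (Real.log (A / (L - y)) / Real.log (A / L)) ^ r +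
          r * (Real.log (A / (L - y)) / Real.log (A / L)) ^ r * (Real.log (A / (L - y)) - 1)) /
        ((L - y) ^ 2 * Real.log (A / (L - y)) ^ 2)) x := by
  have hgc := (calBulk_hasDerivAt_g (r := r) hA hLx hu huL).continuousAt
  have huc := (calBulk_hasDerivAt_u hA hLx).continuousAt
  have hLc := ((hasDerivAt_id' x).const_sub L).continuousAt
  have hnum := ((continuousAt_const (y := r ^ 2)).fun_mul hgc).fun_add
    (((continuousAt_const (y := r)).fun_mul hgc).fun_mul (huc.fun_sub (continuousAt_const (y := 1))))
  have hdc := (hLc.fun_pow 2).fun_mul (huc.fun_pow 2)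
  exact hnum.div₀ hdc (mul_ne_zero (pow_ne_zero 2 hLx.ne') (pow_ne_zero 2 hu.ne'))

/-- Continuity of `ρ g₁` at a point of `(-∞, L)` where `u > 0`. -/
private lemma calBulk_continuousAt_rho_g {L A r x : ℝ} (hA : 0 < A) (hLx : 0 < L - x)
    (hu : 0 < Real.log (A / (L - x))) (huL : 0 < Real.log (A / L)) :
    ContinuousAt (fun t : ℝ => 1 / ((L - t) ^ 2 * Real.log (A / (L - t)) ^ 2) *
      (Real.log (A / (L - t)) / Real.log (A / L)) ^ r) x := by
  have hgc := (calBulk_hasDerivAt_g (r := r) hA hLx hu huL).continuousAt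
  have huc := (calBulk_hasDerivAt_u hA hLx).continuousAt
  have hLc := ((hasDerivAt_id' x).const_sub L).continuousAt
  have hdc := (hLc.fun_pow 2).fun_mul (huc.fun_pow 2)
  exact ((continuousAt_const (y := (1 : ℝ))).div₀ hdc
    (mul_ne_zero (pow_ne_zero 2 hLx.ne') (pow_ne_zero 2 hu.ne'))).fun_mul hgc

/-- The integrated second-derivative inequality `h(0) + r² ∫₀ʸ ρ g₁ ≤ h(y)` on `[0, L)`. -/
private lemma calBulk_integral_ineq {L A r : ℝ} (hL : 0 < L) (hA : Real.exp 1 * L ≤ A)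
    (hr : 0 < r) {y : ℝ} (hy : y ∈ Set.Ico (0 : ℝ) L) :
    r / (L * Real.log (A / L)) +
        r ^ 2 * ∫ t in (0 : ℝ)..y, (1 / ((L - t) ^ 2 * Real.log (A / (L - t)) ^ 2)) *
          (Real.log (A / (L - t)) / Real.log (A / L)) ^ r ≤
      r * (Real.log (A / (L - y)) / Real.log (A / L)) ^ r /
        ((L - y) * Real.log (A / (L - y))) := by
  have hApos : 0 < A := lt_of_lt_of_le (mul_pos (Real.exp_pos 1) hL) hA
  have huL : 1 ≤ Real.log (A / L) := calBulk_one_le_log hA hL le_rfl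
  have huL0 : 0 < Real.log (A / L) := one_pos.trans_le huL
  have hy0 : (0 : ℝ) ≤ y := hy.1
  have hpt : ∀ x ∈ Set.Icc (0 : ℝ) y, 0 < L - x ∧ 1 ≤ Real.log (A / (L - x)) := fun x hx =>
    ⟨by linarith [hx.2, hy.2],
      calBulk_one_le_log hA (by linarith [hx.2, hy.2]) (sub_le_self _ hx.1)⟩
  have hderiv : ∀ x ∈ Set.uIcc (0 : ℝ) y,
      HasDerivAt (fun y : ℝ => r * (Real.log (A / (L - y)) / Real.log (A / L)) ^ r /
          ((L - y) * Real.log (A / (L - y))))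
        ((r ^ 2 * (Real.log (A / (L - x)) / Real.log (A / L)) ^ r +
            r * (Real.log (A / (L - x)) / Real.log (A / L)) ^ r * (Real.log (A / (L - x)) - 1)) /
          ((L - x) ^ 2 * Real.log (A / (L - x)) ^ 2)) x := by
    intro x hx
    rw [Set.uIcc_of_le hy0] at hx
    obtain ⟨hLx, hux⟩ := hpt x hx
    exact calBulk_hasDerivAt_h hApos hLx (one_pos.trans_le hux) huL0
  have hint : IntervalIntegrable (fun x : ℝ =>
      (r ^ 2 * (Real.log (A / (L - x)) / Real.log (A / L)) ^ r +
          r * (Real.log (A / (L - x)) / Real.log (A / L)) ^ r * (Real.log (A / (L - x)) - 1)) /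
        ((L - x) ^ 2 * Real.log (A / (L - x)) ^ 2)) volume 0 y := by
    refine ContinuousOn.intervalIntegrable_of_Icc hy0 fun x hx => ?_
    obtain ⟨hLx, hux⟩ := hpt x hx
    exact (calBulk_continuousAt_h' hApos hLx (one_pos.trans_le hux) huL0).continuousWithinAt
  have hFTC := intervalIntegral.integral_eq_sub_of_hasDerivAt hderiv hint
  have hint2 : IntervalIntegrable (fun t : ℝ => r ^ 2 *
      (1 / ((L - t) ^ 2 * Real.log (A / (L - t)) ^ 2) *
        (Real.log (A / (L - t)) / Real.log (A / L)) ^ r)) volume 0 y := by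
    refine (ContinuousOn.intervalIntegrable_of_Icc hy0 fun x hx => ?_).const_mul (r ^ 2)
    obtain ⟨hLx, hux⟩ := hpt x hx
    exact (calBulk_continuousAt_rho_g hApos hLx (one_pos.trans_le hux) huL0).continuousWithinAt
  have hmono : (∫ t in (0 : ℝ)..y, r ^ 2 *
      (1 / ((L - t) ^ 2 * Real.log (A / (L - t)) ^ 2) *
        (Real.log (A / (L - t)) / Real.log (A / L)) ^ r)) ≤
      ∫ x in (0 : ℝ)..y,
        (r ^ 2 * (Real.log (A / (L - x)) / Real.log (A / L)) ^ r +
            r * (Real.log (A / (L - x)) / Real.log (A / L)) ^ r * (Real.log (A / (L - x)) - 1)) /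
          ((L - x) ^ 2 * Real.log (A / (L - x)) ^ 2) := by
    refine intervalIntegral.integral_mono_on hy0 hint2 hint fun x hx => ?_
    obtain ⟨hLx, hux⟩ := hpt x hx
    have hux0 : 0 < Real.log (A / (L - x)) := one_pos.trans_le hux
    have hD : 0 < (L - x) ^ 2 * Real.log (A / (L - x)) ^ 2 := by positivity
    have hg0 : 0 ≤ (Real.log (A / (L - x)) / Real.log (A / L)) ^ r :=
      Real.rpow_nonneg (div_nonneg hux0.le huL0.le) r
    have hkey : 0 ≤ r * (Real.log (A / (L - x)) / Real.log (A / L)) ^ r *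
        (Real.log (A / (L - x)) - 1) / ((L - x) ^ 2 * Real.log (A / (L - x)) ^ 2) :=
      div_nonneg (mul_nonneg (mul_nonneg hr.le hg0) (sub_nonneg.mpr hux)) hD.le
    have hsplit : (r ^ 2 * (Real.log (A / (L - x)) / Real.log (A / L)) ^ r +
            r * (Real.log (A / (L - x)) / Real.log (A / L)) ^ r * (Real.log (A / (L - x)) - 1)) /
          ((L - x) ^ 2 * Real.log (A / (L - x)) ^ 2) =
        r ^ 2 * (1 / ((L - x) ^ 2 * Real.log (A / (L - x)) ^ 2) *
            (Real.log (A / (L - x)) / Real.log (A / L)) ^ r) +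
          r * (Real.log (A / (L - x)) / Real.log (A / L)) ^ r *
            (Real.log (A / (L - x)) - 1) / ((L - x) ^ 2 * Real.log (A / (L - x)) ^ 2) := by
      ring
    rw [hsplit]
    linarith
  rw [intervalIntegral.integral_const_mul] at hmono
  have h0 : r * (Real.log (A / (L - 0)) / Real.log (A / L)) ^ r / ((L - 0) * Real.log (A / (L - 0)))
      = r / (L * Real.log (A / L)) := by
    rw [sub_zero, div_self huL0.ne', Real.one_rpow, mul_one]
  linarith [hFTC, hmono, h0]

/-- The bulk piece `g₁(y) = (log(A/(L-y))/log(A/L))^r` of the supersolution: derivative, values,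
monotonicity and the integrated second-derivative inequality on `[0, L)`. -/
theorem stub_calBulk : ∀ (L A r : ℝ), 0 < L → Real.exp 1 * L ≤ A → 0 < r →
    (∀ y ∈ Set.Ico 0 L, HasDerivAt (fun y : ℝ => (Real.log (A / (L - y)) / Real.log (A / L)) ^ r)
      (r * (Real.log (A / (L - y)) / Real.log (A / L)) ^ r / ((L - y) * Real.log (A / (L - y)))) y) ∧
    ContinuousOn (fun y : ℝ => r * (Real.log (A / (L - y)) / Real.log (A / L)) ^ r /
      ((L - y) * Real.log (A / (L - y)))) (Set.Ico 0 L) ∧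
    (fun y : ℝ => (Real.log (A / (L - y)) / Real.log (A / L)) ^ r) 0 = 1 ∧
    (∀ y ∈ Set.Ico 0 L, 1 ≤ (Real.log (A / (L - y)) / Real.log (A / L)) ^ r) ∧
    MonotoneOn (fun y : ℝ => (Real.log (A / (L - y)) / Real.log (A / L)) ^ r) (Set.Ico 0 L) ∧
    ∀ y ∈ Set.Ico 0 L,
      r / (L * Real.log (A / L)) +
        r ^ 2 * ∫ t in (0 : ℝ)..y, (1 / ((L - t) ^ 2 * Real.log (A / (L - t)) ^ 2)) *
          (Real.log (A / (L - t)) / Real.log (A / L)) ^ r ≤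
      r * (Real.log (A / (L - y)) / Real.log (A / L)) ^ r / ((L - y) * Real.log (A / (L - y))) := by
  intro L A r hL hA hr
  have hApos : 0 < A := lt_of_lt_of_le (mul_pos (Real.exp_pos 1) hL) hA
  have huL : 1 ≤ Real.log (A / L) := calBulk_one_le_log hA hL le_rfl
  have huL0 : 0 < Real.log (A / L) := one_pos.trans_le huL
  have hpt : ∀ x ∈ Set.Ico (0 : ℝ) L, 0 < L - x ∧ 1 ≤ Real.log (A / (L - x)) := fun x hx =>
    ⟨sub_pos.mpr hx.2, calBulk_one_le_log hA (sub_pos.mpr hx.2) (sub_le_self _ hx.1)⟩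
  refine ⟨?_, ?_, ?_, ?_, ?_, fun y hy => calBulk_integral_ineq hL hA hr hy⟩
  · intro y hy
    obtain ⟨hLy, huy⟩ := hpt y hy
    exact calBulk_hasDerivAt_g hApos hLy (one_pos.trans_le huy) huL0
  · intro y hy
    obtain ⟨hLy, huy⟩ := hpt y hy
    exact (calBulk_hasDerivAt_h hApos hLy (one_pos.trans_le huy) huL0).continuousAt.continuousWithinAt
  · show (Real.log (A / (L - 0)) / Real.log (A / L)) ^ r = 1
    rw [sub_zero, div_self huL0.ne', Real.one_rpow]
  · intro y hy
    obtain ⟨hLy, huy⟩ := hpt y hy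
    refine Real.one_le_rpow ?_ hr.le
    rw [one_le_div huL0]
    simpa using calBulk_log_mono (L := L) (a := 0) hApos hy.2 hy.1
  · intro a ha b hb hab
    have hua : 0 ≤ Real.log (A / (L - a)) := zero_le_one.trans (hpt a ha).2
    exact Real.rpow_le_rpow (div_nonneg hua huL0.le)
      (div_le_div_of_nonneg_right (calBulk_log_mono hApos hb.2 hab) huL0.le) hr.le

end Summit.RiemannHypothesis.RiemannHypothesis.Theorems.LeeYangTelegraphString
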